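import Literature.Analysis.FluidPDE.FluidComputer.GalerkinUniqueness
import Mathlib.Analysis.Calculus.ContDiff.Deriv
import Mathlib.Analysis.InnerProductSpace.Calculus
import HarnessLib

/-!
# Galerkin solutions are smooth in time: the Taylor jets the exact-series tools compute exist

HONEST FRAMING: typed infrastructure for a low prior, high value-of-information experiment on
Tao's machine paradigm; NOT a claim that NS blows up.

The Galerkin truncation of the (forced, viscous or inviscid) Navier–Stokes system on a finite mode
set `S` is a finite-dimensional ODE with a POLYNOMIAL (quadratic) vector field
[cite: DoeringGibbon1995, §5.3 (5.3.12)–(5.3.14)]; `GalerkinUniqueness` (this tree) identifies every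
supported Galerkin solution with an integral curve of that field (`GalerkinODE.hasDerivAt_restrict`)
and proves the field is `C¹` (`GalerkinODE.contDiff_vf`).  Here:

* `contDiff_vf_all`: the vector field is `C^n` for every `n` (it is polynomial);
* `contDiff_top_of_hasDerivAt_autonomous`: the elementary bootstrap — an everywhere-differentiable
  curve `F` with `F' = Φ ∘ F` for a `C^∞` field `Φ` is `C^∞` (induction on the order via
  `contDiff_succ_iff_deriv`);
* hence every Galerkin solution with time-independent forcing, supported in `S`, is `C^∞` as a
  phase-space curve (`contDiff_restrict`), and so are all its coefficients (`contDiff_coeff`), modal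
  energies (`contDiff_modalEnergy`), the truncated energy and enstrophy on any mode set
  (`contDiff_truncEnergy`, `contDiff_truncEnstrophy`) — in particular all their iterated
  time-derivatives exist in the honest sense, which is what statements about Taylor coefficients
  (`TimeParity`, `FamilySymmetry`, the cell's exact inviscid series) refer to
  [cite: RobinsonRodrigoSadowski2016, Thm. 4.4 Step 1 (the Galerkin system as a smooth ODE)].

0 sorry, 0 named facts.
-/

noncomputable section

namespace Summit.NavierStokesRegularity.FluidComputer.GalerkinSmooth

open Literature.Analysis.FluidPDE.FluidComputer
open Literature.Analysis.FluidPDE.FluidComputer.ShellTransfer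
open Literature.Analysis.FluidPDE.FluidComputer.ShellTransfer.GalerkinODE
open Complex
open scoped BigOperators ContDiff

variable (S : Finset (Fin 3 → ℤ))

/-! ## The vector field is smooth at every order -/

/-- Coordinates are `C^n`. [folklore] -/
theorem contDiff_coord_all {n : WithTop ℕ∞} (k : ↥S) (j : Fin 3) :
    ContDiff ℝ n (fun x : ↥S → Fin 3 → ℂ => x k j) :=
  contDiff_pi.1 (contDiff_pi.1 contDiff_id k) j

/-- The extension by zero is `C^n` in the phase-space point. [folklore] -/
theorem contDiff_extend_all {n : WithTop ℕ∞} (p : Fin 3 → ℤ) (j : Fin 3) :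
    ContDiff ℝ n (fun x : ↥S → Fin 3 → ℂ => extend S x p j) := by
  unfold extend
  by_cases hp : p ∈ S
  · simp only [dif_pos hp]
    exact contDiff_coord_all S ⟨p, hp⟩ j
  · simp only [dif_neg hp]
    exact contDiff_const

/-- `x ↦ k · x̃(q)` is `C^n`. [folklore] -/
theorem contDiff_kdot_extend_all {n : WithTop ℕ∞} (k q : Fin 3 → ℤ) :
    ContDiff ℝ n (fun x : ↥S → Fin 3 → ℂ => kdot k (extend S x q)) := by
  unfold kdot
  exact ContDiff.sum fun i _ => contDiff_const.mul (contDiff_extend_all S q i)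

/-- The truncated advection term is `C^n` (a quadratic polynomial). [folklore] -/
theorem contDiff_advArr_all {n : WithTop ℕ∞} (k : Fin 3 → ℤ) (j : Fin 3) :
    ContDiff ℝ n (fun x : ↥S → Fin 3 → ℂ => advArr S x k j) := by
  unfold advArr
  exact contDiff_const.mul (ContDiff.sum fun p _ =>
    (contDiff_kdot_extend_all S k (k - p)).mul (contDiff_extend_all S p j))

/-- **The Galerkin vector field is `C^n` for every `n`** (polynomial).
[cite: RobinsonRodrigoSadowski2016, Thm. 4.4 Step 1] -/
theorem contDiff_vf_all {n : WithTop ℕ∞} (ν : ℝ) (g : (Fin 3 → ℤ) → Fin 3 → ℂ) :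
    ContDiff ℝ n (vf S ν g) := by
  rw [contDiff_pi]
  intro k
  rw [contDiff_pi]
  intro j
  unfold vf
  simp only [leray_apply]
  have hN : ∀ i, ContDiff ℝ n (fun x : ↥S → Fin 3 → ℂ => advArr S x k i + g k i) :=
    fun i => (contDiff_advArr_all S k i).add contDiff_const
  have hkd : ContDiff ℝ n
      (fun x : ↥S → Fin 3 → ℂ => kdot (k : Fin 3 → ℤ) (fun i => advArr S x k i + g k i)) := by
    unfold kdot
    exact ContDiff.sum fun i _ => contDiff_const.mul (hN i)
  exact ((contDiff_const.mul (contDiff_coord_all S k j)).add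
    ((hN j).sub ((hkd.div_const _).mul contDiff_const)))

/-! ## The bootstrap: integral curves of smooth autonomous fields are smooth -/

/-- **An everywhere-differentiable curve solving `F' = Φ(F)` for a `C^∞` field `Φ` is `C^∞`.**
Induction on the order: `F` is differentiable, and `deriv F = Φ ∘ F` is `C^n` when `F` is.
[folklore] -/
theorem contDiff_top_of_hasDerivAt_autonomous {E : Type*} [NormedAddCommGroup E] [NormedSpace ℝ E]
    {F : ℝ → E} {Φ : E → E} (hΦ : ContDiff ℝ ∞ Φ) (hF : ∀ s, HasDerivAt F (Φ (F s)) s) :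
    ContDiff ℝ ∞ F := by
  have hdiff : Differentiable ℝ F := fun s => (hF s).differentiableAt
  have hder : deriv F = fun s => Φ (F s) := funext fun s => (hF s).deriv
  rw [contDiff_infty]
  intro n
  induction n with
  | zero => exact contDiff_zero.2 hdiff.continuous
  | succ n ih =>
    rw [Nat.cast_succ]
    refine contDiff_succ_iff_deriv.2 ⟨hdiff, by simp, ?_⟩
    rw [hder]
    exact (contDiff_infty.1 hΦ n).comp ih

/-! ## Galerkin solutions with time-independent forcing are smooth -/

variable {S}
variable {U : ℝ → FourierVelocity} {ν : ℝ} {c : ℝ → (Fin 3 → ℤ) → ℂ} {f : (Fin 3 → ℤ) → Fin 3 → ℂ}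

/-- **Every Galerkin solution (time-independent forcing) supported in `S` is a `C^∞` phase-space
curve.** [cite: RobinsonRodrigoSadowski2016, Thm. 4.4 Step 1] -/
theorem contDiff_restrict (hU : IsGalerkinSolution U S ν c fun _ => f) (hs : IsSupportedOn U S) :
    ContDiff ℝ ∞ (fun t => restrict S (U t)) :=
  contDiff_top_of_hasDerivAt_autonomous (contDiff_vf_all S ν f)
    fun s => hasDerivAt_restrict S hU hs s

/-- **Every coefficient `t ↦ û_j(k, t)` is `C^∞`** (on `S` a coordinate of the curve, off `S` zero).
[folklore] -/
theorem contDiff_coeff (hU : IsGalerkinSolution U S ν c fun _ => f) (hs : IsSupportedOn U S)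
    (k : Fin 3 → ℤ) (j : Fin 3) : ContDiff ℝ ∞ (fun t => (U t).coeff k j) := by
  by_cases hk : k ∈ S
  · have h := (contDiff_coord_all S ⟨k, hk⟩ j).comp (contDiff_restrict hU hs)
    exact h
  · have e : (fun t => (U t).coeff k j) = fun _ => 0 := by
      funext t
      rw [hs t k hk]
      rfl
    rw [e]
    exact contDiff_const

/-- **Every modal energy `t ↦ E(k, t) = ½|û(k,t)|²` is `C^∞`.** [folklore] -/
theorem contDiff_modalEnergy (hU : IsGalerkinSolution U S ν c fun _ => f) (hs : IsSupportedOn U S)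
    (k : Fin 3 → ℤ) : ContDiff ℝ ∞ (fun t => modalEnergy (U t) k) := by
  unfold modalEnergy
  refine contDiff_const.mul (ContDiff.sum fun j _ => ?_)
  have e : (fun t => Complex.normSq ((U t).coeff k j)) = fun t => ‖(U t).coeff k j‖ ^ 2 := by
    funext t
    exact Complex.normSq_eq_norm_sq _
  rw [e]
  exact (contDiff_coeff hU hs k j).norm_sq ℝ

/-- **The truncated energy on any mode set is `C^∞` in time.** [folklore] -/
theorem contDiff_truncEnergy (hU : IsGalerkinSolution U S ν c fun _ => f) (hs : IsSupportedOn U S)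
    (T : Finset (Fin 3 → ℤ)) : ContDiff ℝ ∞ (fun t => truncEnergy (U t) T) := by
  unfold truncEnergy
  exact ContDiff.sum fun k _ => contDiff_modalEnergy hU hs k

/-- **The truncated enstrophy on any mode set is `C^∞` in time** — so all its Taylor coefficients at
any time exist in the honest sense. [folklore] -/
theorem contDiff_truncEnstrophy (hU : IsGalerkinSolution U S ν c fun _ => f)
    (hs : IsSupportedOn U S) (T : Finset (Fin 3 → ℤ)) :
    ContDiff ℝ ∞ (fun t => truncEnstrophy (U t) T) := by
  unfold truncEnstrophy
  exact ContDiff.sum fun k _ => contDiff_const.mul (contDiff_modalEnergy hU hs k)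

/-- The unforced case in the tree's spelling `fun _ _ _ => 0`. [folklore] -/
theorem contDiff_truncEnstrophy_unforced (hU : IsGalerkinSolution U S ν c fun _ _ _ => 0)
    (hs : IsSupportedOn U S) (T : Finset (Fin 3 → ℤ)) :
    ContDiff ℝ ∞ (fun t => truncEnstrophy (U t) T) :=
  contDiff_truncEnstrophy (f := fun _ _ => 0) hU hs T

/-- In particular the enstrophy curve is differentiable any number of times: every iterated
derivative is again differentiable. [folklore] -/
theorem differentiable_iteratedDeriv_truncEnstrophy (hU : IsGalerkinSolution U S ν c fun _ => f)
    (hs : IsSupportedOn U S) (T : Finset (Fin 3 → ℤ)) (n : ℕ) :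
    Differentiable ℝ (iteratedDeriv n fun t => truncEnstrophy (U t) T) :=
  (contDiff_truncEnstrophy hU hs T).differentiable_iteratedDeriv n
    (WithTop.coe_lt_coe.2 (ENat.coe_lt_top n))

end Summit.NavierStokesRegularity.FluidComputer.GalerkinSmooth

end
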